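import Summits.Parity.GeneralizedHardyLittlewood.Theses.LeeYangFibres
import Literature.Barriers.Parity.SiegelZeroPrimePairs
import Literature.NumberTheory.LFunctions.RHWave0

/-!
# Crux stmt-Parity-14116 (`LeeYangFibres.AbsoluteUpgrade := RelativeDimOne → DimOne`) —
# ideator 3, round 1: first lemmas of the two idea cards

* card `divergent-degree-clipping`: the rate currency (`dimOne_of_rate`), the quantifier-swapped
  cell statement `PrimeCellsAbsolute`, the sorry-free composition
  `absoluteUpgrade_of_primeCellsAbsolute`, and the shapes of the line's stubs
  (`CellParityLawRate`, `FibreHyperbolicityUpTo`, `ModelThresholdDecayWith`, `RobustClipping`).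
* card `siegel-immune-localisation`: `noSiegelZeros_of_relativeDimOne` (RelativeDimOne + the tree
  fact `MatomakiMerikoski2023_pairCorrelation` ⟹ `NoSiegelZeros`).

Nothing here is a proof; `sorry` marks the statements the line must prove.
-/

namespace Summit.Parity.GeneralizedHardyLittlewood.Cruxes.AbsoluteUpgrade.Ideator3

open Literature.NumberTheory.Sieve Filter
open scoped Classical
open Summit.Parity.GeneralizedHardyLittlewood.Theses.LeeYangFibres

/-! ### Card 1 — divergent-degree clipping -/

/-- (parity-free, provable now; Green–Tao Lemma 1.3 + Mertens) For `d = 1` systems of `t` forms of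
size `≤ L` at scale `N`, `∏_p β_p(Ψ) ≤ C (log log N)^{t-1}`: `β_p ≤ (p/(p-1))^{t-1}` for `p > L`,
collisions only at `p ∣ Δ(Ψ) = ∏ aᵢ ∏_{i<j}(aᵢbⱼ - aⱼbᵢ)`, `|Δ| ≤ (2L²N)^{t²}`. -/
def SingularProductLogLogBound : Prop :=
  ∀ (t L : ℕ), 1 ≤ t → ∃ C : ℝ, 0 < C ∧ ∃ N₀ : ℕ, ∀ N : ℕ, N₀ ≤ N →
    ∀ Ψ : Fin t → AffLinForm 1, IsNondegenerateSystem Ψ → affLinSize Ψ N ≤ L →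
      singularProduct Ψ ≤ C * Real.log (Real.log N) ^ (t - 1)

/-- `RelativeDimOne` with an explicit rate `ρ t N` in place of `ε`. -/
def RelativeDimOneRate (ρ : ℕ → ℕ → ℝ) : Prop :=
  ∀ (t L : ℕ), 1 ≤ t → ∃ N₀ : ℕ, ∀ N : ℕ, N₀ ≤ N → ∀ Ψ : Fin t → AffLinForm 1,
    IsNondegenerateSystem Ψ → affLinSize Ψ N ≤ L → ∀ K : Set (Fin 1 → ℝ), Convex ℝ K →
      K ⊆ realBox 1 N →
        |vonMangoldtSum Ψ K N - archFactor Ψ K * singularProduct Ψ| ≤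
          ρ t N * (archFactor Ψ K * singularProduct Ψ + N)

/-- THE RATE CURRENCY of the crux (provable now from `SingularProductLogLogBound` and
`archFactor ≤ 2N`): any rate `ρ t N = o((log log N)^{1-t})` in the relative statement is already
the absolute statement `DimOne`. -/
theorem dimOne_of_rate (hB : SingularProductLogLogBound) (ρ : ℕ → ℕ → ℝ)
    (hρ0 : ∀ t N, 0 ≤ ρ t N)
    (hρ : ∀ t : ℕ, 1 ≤ t →
      Tendsto (fun N : ℕ => ρ t N * Real.log (Real.log N) ^ (t - 1)) atTop (nhds 0))
    (h : RelativeDimOneRate ρ) : DimOne := by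
  sorry

/-- The route's prime cells with ABSOLUTE error and an `N`-dependent roughness `u = u(N)` (the
quantifier swap `∃ u ∀ N ↦ ∀ N ∃ u`): same inlined cells as `PrimeCellsRelative`. -/
def PrimeCellsAbsolute : Prop :=
  ∀ (t L : ℕ), 1 ≤ t → ∀ ε : ℝ, 0 < ε → ∃ N₀ : ℕ, ∀ N : ℕ, N₀ ≤ N → ∃ u : ℕ, 2 ≤ u ∧
    ∀ Ψ : Fin t → AffLinForm 1, IsNondegenerateSystem Ψ → affLinSize Ψ N ≤ L →
      ∀ K : Set (Fin 1 → ℝ), Convex ℝ K → K ⊆ realBox 1 N →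
        |((((latticeBox 1 N).filter (fun n => realPoint n ∈ K ∧ ∀ i,
              (N : ℝ) ^ ((1 : ℝ) / u) < (Nat.minFac ((Ψ i).eval n).toNat : ℝ) ∧
                ArithmeticFunction.cardFactors ((Ψ i).eval n).toNat = 1)).card : ℕ) : ℝ) -
            archFactor Ψ K * singularProduct Ψ *
              (((((Finset.Icc 1 N).filter (fun m => (N : ℝ) ^ ((1 : ℝ) / u) < (Nat.minFac m : ℝ) ∧
                  ArithmeticFunction.cardFactors m = 1)).card : ℕ) : ℝ) / N) ^ t| ≤
          ε * N / Real.log N ^ t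

/-- Partial summation with `u = u(N)` (provable now, as `CellsToRelativeDimOne`; the primes
`≤ N^{1/u}` cost `O(t N^{1/2} log^t N)` whatever `u ≥ 2` is). -/
def CellsToDimOne : Prop := PrimeCellsAbsolute → DimOne

/-- The line concludes the crux BY NAME (sorry-free): it proves the consequent. -/
theorem absoluteUpgrade_of_primeCellsAbsolute (h₁ : PrimeCellsAbsolute) (h₂ : CellsToDimOne) :
    AbsoluteUpgrade :=
  fun _ => h₂ h₁

/-- `CellParityLaw` with a rate `ρ t u N` in place of `ε` (and `u` quantified after `N`). -/
def CellParityLawRate (ρ : ℕ → ℕ → ℕ → ℝ) : Prop :=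
  ∀ (t L : ℕ), 1 ≤ t → ∃ N₀ : ℕ, ∀ N : ℕ, N₀ ≤ N → ∀ u : ℕ, 2 ≤ u →
    ∀ Ψ : Fin t → AffLinForm 1, IsNondegenerateSystem Ψ → affLinSize Ψ N ≤ L →
      ∀ K : Set (Fin 1 → ℝ), Convex ℝ K → K ⊆ realBox 1 N →
        ∃ θ : Finset (Fin t) → ℝ, θ ∅ = 1 ∧ (∀ S, |θ S| ≤ 2) ∧ ∀ j : Fin t → ℕ,
          (∀ i, 1 ≤ j i ∧ j i ≤ u) →
            |((((latticeBox 1 N).filter (fun n => realPoint n ∈ K ∧ ∀ i,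
                  (N : ℝ) ^ ((1 : ℝ) / u) < (Nat.minFac ((Ψ i).eval n).toNat : ℝ) ∧
                    ArithmeticFunction.cardFactors ((Ψ i).eval n).toNat = j i)).card : ℕ) : ℝ) -
                (∑ S : Finset (Fin t), θ S * ∏ i ∈ S, (-1 : ℝ) ^ (j i + 1)) *
                  (archFactor Ψ K * singularProduct Ψ * ∏ i,
                    ((((Finset.Icc 1 N).filter (fun m => (N : ℝ) ^ ((1 : ℝ) / u) < (Nat.minFac m : ℝ) ∧
                        ArithmeticFunction.cardFactors m = j i)).card : ℕ) : ℝ) / N)| ≤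
              ρ t u N * N / Real.log N ^ t

/-- `FibreHyperbolicity` for ALL degrees `2 ≤ u ≤ U(N)` at scale `N` (threshold effectivity:
`N₀(u) ≤ U⁻¹(u)`), same fibre sums as the crux `FibreHyperbolicity`. -/
def FibreHyperbolicityUpTo (U : ℕ → ℕ) : Prop :=
  ∀ (t L : ℕ), 1 ≤ t → ∀ η : ℝ, 0 < η → ∃ N₀ : ℕ, ∀ N : ℕ, N₀ ≤ N → ∀ u : ℕ, 2 ≤ u → u ≤ U N →
    ∀ Ψ : Fin t → AffLinForm 1, IsNondegenerateSystem Ψ → affLinSize Ψ N ≤ L →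
      ∀ K : Set (Fin 1 → ℝ), Convex ℝ K → K ⊆ realBox 1 N →
        η * (N : ℝ) ≤ archFactor Ψ K * singularProduct Ψ → ∀ i : Fin t, ∀ w : Fin t → ℝ,
          (∀ k, 0 < w k ∧ w k ≤ 1) → ∀ ζ : ℂ,
            (∑ j ∈ Fintype.piFinset (fun _ : Fin t => Finset.Icc 1 u),
              ((((latticeBox 1 N).filter (fun n => realPoint n ∈ K ∧ ∀ k,
                  (N : ℝ) ^ ((1 : ℝ) / u) < (Nat.minFac ((Ψ k).eval n).toNat : ℝ) ∧
                    ArithmeticFunction.cardFactors ((Ψ k).eval n).toNat = j k)).card : ℕ) : ℂ) *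
                ∏ k, (if k = i then ζ else ((w k : ℝ) : ℂ)) ^ (j k)) = 0 → ζ.im = 0

/-- MODEL THRESHOLD DECAY (parity-free): an alternating twist of relative size `> C e^{-c u}`
destroys the real-rootedness of the rough-integer cell polynomial `∑_j A_j(x) z^j` (kit j013661 /
sibling tables: `θ*(u) = e^{-(0.95±0.05)u}`, binding gap `⌊(u-1)/3⌋`). -/
def ModelThresholdDecayWith (c C : ℝ) : Prop :=
  0 < c ∧ 0 < C ∧ ∀ u : ℕ, 2 ≤ u → ∃ x₀ : ℕ, ∀ x : ℕ, x₀ ≤ x → ∀ θ : ℝ,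
    C * Real.exp (-c * u) < |θ| → |θ| ≤ 1 / 2 →
      ∃ z : ℂ, (∑ j ∈ Finset.range (u + 1),
        ((((Finset.Icc 1 x).filter (fun n => (x : ℝ) ^ ((1 : ℝ) / u) < (Nat.minFac n : ℝ) ∧
            ArithmeticFunction.cardFactors n = j)).card : ℕ) : ℂ) *
          (((1 + θ * (-1 : ℝ) ^ (j + 1) : ℝ)) : ℂ) * z ^ j) = 0 ∧ z.im ≠ 0

/-- ROBUST QUANTITATIVE CLIPPING (the load-bearing stub; Newton at two bulk cells is replaced by
the full sign certificate at the binding gap, cells above `j_c ≈ 0.8u` capped by parity-free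
upper-bound sieves). Schedule: `U(N) → ∞` with `e^{-cU(N)} (log log N)^{t-1} → 0`, and a law rate
beating the `|ζ_b|^j`-amplified budget `e^{-cU - 2U log U}`. -/
def RobustClipping (c C : ℝ) : Prop :=
  ∀ (U : ℕ → ℕ) (ρ : ℕ → ℕ → ℕ → ℝ),
    (∀ t : ℕ, 1 ≤ t → Tendsto (fun N : ℕ =>
        Real.exp (-c * U N) * Real.log (Real.log N) ^ (t - 1)) atTop (nhds 0)) →
    (∀ t : ℕ, 1 ≤ t → Tendsto (fun N : ℕ =>
        ρ t (U N) N * Real.exp (c * U N + 2 * U N * Real.log (U N)) *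
          Real.log (Real.log N) ^ (t - 1)) atTop (nhds 0)) →
    Tendsto U atTop atTop →
      CellParityLawRate ρ → FibreHyperbolicityUpTo U → ModelThresholdDecayWith c C →
        ModelCellFacts → PrimeCellsAbsolute

/-- Shape of the whole line (sorry = the stubs `RobustClipping`, `CellsToDimOne` and the inputs). -/
theorem absoluteUpgrade_of_line {c C : ℝ} (U : ℕ → ℕ) (ρ : ℕ → ℕ → ℕ → ℝ)
    (hU₁ : ∀ t : ℕ, 1 ≤ t → Tendsto (fun N : ℕ =>
        Real.exp (-c * U N) * Real.log (Real.log N) ^ (t - 1)) atTop (nhds 0))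
    (hU₂ : ∀ t : ℕ, 1 ≤ t → Tendsto (fun N : ℕ =>
        ρ t (U N) N * Real.exp (c * U N + 2 * U N * Real.log (U N)) *
          Real.log (Real.log N) ^ (t - 1)) atTop (nhds 0))
    (hU₃ : Tendsto U atTop atTop)
    (hLaw : CellParityLawRate ρ) (hFH : FibreHyperbolicityUpTo U) (hM : ModelThresholdDecayWith c C)
    (hCells : ModelCellFacts) (hClip : RobustClipping c C) (hSum : CellsToDimOne) :
    AbsoluteUpgrade :=
  absoluteUpgrade_of_primeCellsAbsolute (hClip U ρ hU₁ hU₂ hU₃ hLaw hFH hM hCells) hSum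

/-! ### Card 2 — Siegel immunity of the hypothesis -/

/-- FIRST LEMMA of card `siegel-immune-localisation` (provable, size M–L): the crux's hypothesis
kills exceptional zeros. If `L(β₀, χ) = 0` with `β₀ = 1 - 1/(η log q)`, `η ≥ η₀`, Matomäki–Merikoski
Thm 1.3 at `X = q^{10}`, `h = 2q` gives `∑_{n ≤ X} Λ(n)Λ(n+2q) ≥ (2 - o(1)) 𝔖_{2q} X`, against
`RelativeDimOne` (`t = 2`, `L = 3`, `K = [0, X]`, `ε = 1/10`); small `q` by continuity of `L(·, χ)`
at `1` (Mathlib: non-vanishing on `re s ≥ 1`). -/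
theorem noSiegelZeros_of_relativeDimOne
    (hMM : Literature.Barriers.Parity.MatomakiMerikoski2023_pairCorrelation)
    (hR : RelativeDimOne) : Literature.NumberTheory.LFunctions.NoSiegelZeros := by
  sorry

end Summit.Parity.GeneralizedHardyLittlewood.Cruxes.AbsoluteUpgrade.Ideator3
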